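import Summits.MatrixMultiplication.MatrixMultiplication.Theorems.PairwiseCurvedTilingsLC.Negative.GenericSimpleRoots
import Summits.MatrixMultiplication.MatrixMultiplication.Theorems.PairwiseCurvedTilingsLC.Negative.FactorBookkeeping
import Mathlib.RingTheory.Localization.FractionRing
import Mathlib.RingTheory.Ideal.Maximal
import Mathlib.RingTheory.Ideal.Quotient.Operations
import Mathlib.RingTheory.MvPolynomial.Basic
import Mathlib.Algebra.MvPolynomial.Equiv
import Mathlib.Algebra.MvPolynomial.PDeriv
import Mathlib.Algebra.Polynomial.Derivative
import Mathlib.FieldTheory.Perfect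
import Mathlib.FieldTheory.Separable
import Mathlib.RingTheory.Polynomial.UniqueFactorization
import Mathlib.RingTheory.UniqueFactorizationDomain.NormalizedFactors
import Mathlib.Algebra.CharP.Algebra

/-!
# Generic factorisation over a chart (work file; line LonelyTranslates c1, Prop27Reduction)
-/

set_option linter.dupNamespace false

namespace Summit.MatrixMultiplication.MatrixMultiplication.Theorems.PairwiseCurvedTilingsLC.Negative

open Polynomial

section RelFactor

variable {K : Type} [Field K] {e k : ℕ}

/-- Core of `relFactor`: the lifted, cleared factorisation data and the three test identities,
whose coefficients (after `toFw`) lie in the chart ideal. [folklore] -/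
theorem relFactor_core [CharZero K] (D : Fin k → MvPolynomial (Fin e ⊕ Fin k) K)
    (hmax : (Ideal.span (Set.range fun j => (MvPolynomial.aeval (Sum.elim
      (fun i => MvPolynomial.C (algebraMap (MvPolynomial (Fin e) K)
        (FractionRing (MvPolynomial (Fin e) K)) (MvPolynomial.X i)))
      (fun j => MvPolynomial.X j)) :
        MvPolynomial (Fin e ⊕ Fin k) K →ₐ[K]
          MvPolynomial (Fin k) (FractionRing (MvPolynomial (Fin e) K))) (D j))).IsMaximal)
    (P : Polynomial (MvPolynomial (Fin e) K)) (hP : P ≠ 0) :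
    ∃ (b : MvPolynomial (Fin e) K), b ≠ 0 ∧ ∃ (s N : ℕ) (m : Fin s → ℕ)
      (Q₀ A₀ A₀' : Fin s → Polynomial (MvPolynomial (Fin e ⊕ Fin k) K))
      (U₀ V₀ : Polynomial (MvPolynomial (Fin e ⊕ Fin k) K)),
      (∀ i, Irreducible (((Q₀ i).map (MvPolynomial.aeval (Sum.elim
      (fun i => MvPolynomial.C (algebraMap (MvPolynomial (Fin e) K)
        (FractionRing (MvPolynomial (Fin e) K)) (MvPolynomial.X i)))
      (fun j => MvPolynomial.X j)) :
        MvPolynomial (Fin e ⊕ Fin k) K →ₐ[K]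
          MvPolynomial (Fin k) (FractionRing (MvPolynomial (Fin e) K))).toRingHom).map
          (Ideal.Quotient.mk (Ideal.span (Set.range fun j => (MvPolynomial.aeval (Sum.elim
      (fun i => MvPolynomial.C (algebraMap (MvPolynomial (Fin e) K)
        (FractionRing (MvPolynomial (Fin e) K)) (MvPolynomial.X i)))
      (fun j => MvPolynomial.X j)) :
        MvPolynomial (Fin e ⊕ Fin k) K →ₐ[K]
          MvPolynomial (Fin k) (FractionRing (MvPolynomial (Fin e) K))) (D j)))))) ∧
      (∀ n, ((Polynomial.C (MvPolynomial.rename Sum.inl b) ^ N *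
          P.map (MvPolynomial.rename (Sum.inl : Fin e → Fin e ⊕ Fin k)).toRingHom -
            U₀ * ∏ i, Q₀ i ^ m i).map (MvPolynomial.aeval (Sum.elim
      (fun i => MvPolynomial.C (algebraMap (MvPolynomial (Fin e) K)
        (FractionRing (MvPolynomial (Fin e) K)) (MvPolynomial.X i)))
      (fun j => MvPolynomial.X j)) :
        MvPolynomial (Fin e ⊕ Fin k) K →ₐ[K]
          MvPolynomial (Fin k) (FractionRing (MvPolynomial (Fin e) K))).toRingHom).coeff n ∈
              Ideal.span (Set.range fun j => (MvPolynomial.aeval (Sum.elim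
      (fun i => MvPolynomial.C (algebraMap (MvPolynomial (Fin e) K)
        (FractionRing (MvPolynomial (Fin e) K)) (MvPolynomial.X i)))
      (fun j => MvPolynomial.X j)) :
        MvPolynomial (Fin e ⊕ Fin k) K →ₐ[K]
          MvPolynomial (Fin k) (FractionRing (MvPolynomial (Fin e) K))) (D j))) ∧
      (∀ n, ((U₀ * V₀ - Polynomial.C (MvPolynomial.rename Sum.inl b) ^ 2).map
          (MvPolynomial.aeval (Sum.elim
      (fun i => MvPolynomial.C (algebraMap (MvPolynomial (Fin e) K)
        (FractionRing (MvPolynomial (Fin e) K)) (MvPolynomial.X i)))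
      (fun j => MvPolynomial.X j)) :
        MvPolynomial (Fin e ⊕ Fin k) K →ₐ[K]
          MvPolynomial (Fin k) (FractionRing (MvPolynomial (Fin e) K))).toRingHom).coeff n ∈ Ideal.span (Set.range fun j => (MvPolynomial.aeval (Sum.elim
      (fun i => MvPolynomial.C (algebraMap (MvPolynomial (Fin e) K)
        (FractionRing (MvPolynomial (Fin e) K)) (MvPolynomial.X i)))
      (fun j => MvPolynomial.X j)) :
        MvPolynomial (Fin e ⊕ Fin k) K →ₐ[K]
          MvPolynomial (Fin k) (FractionRing (MvPolynomial (Fin e) K))) (D j))) ∧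
      (∀ i n, ((A₀ i * Q₀ i + A₀' i * derivative (Q₀ i) -
          Polynomial.C (MvPolynomial.rename Sum.inl b) ^ 2).map (MvPolynomial.aeval (Sum.elim
      (fun i => MvPolynomial.C (algebraMap (MvPolynomial (Fin e) K)
        (FractionRing (MvPolynomial (Fin e) K)) (MvPolynomial.X i)))
      (fun j => MvPolynomial.X j)) :
        MvPolynomial (Fin e ⊕ Fin k) K →ₐ[K]
          MvPolynomial (Fin k) (FractionRing (MvPolynomial (Fin e) K))).toRingHom).coeff n ∈
            Ideal.span (Set.range fun j => (MvPolynomial.aeval (Sum.elim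
      (fun i => MvPolynomial.C (algebraMap (MvPolynomial (Fin e) K)
        (FractionRing (MvPolynomial (Fin e) K)) (MvPolynomial.X i)))
      (fun j => MvPolynomial.X j)) :
        MvPolynomial (Fin e ⊕ Fin k) K →ₐ[K]
          MvPolynomial (Fin k) (FractionRing (MvPolynomial (Fin e) K))) (D j))) := by
  classical
  set I : Ideal (MvPolynomial (Fin k) (FractionRing (MvPolynomial (Fin e) K))) := Ideal.span (Set.range fun j => (MvPolynomial.aeval (Sum.elim
      (fun i => MvPolynomial.C (algebraMap (MvPolynomial (Fin e) K)
        (FractionRing (MvPolynomial (Fin e) K)) (MvPolynomial.X i)))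
      (fun j => MvPolynomial.X j)) :
        MvPolynomial (Fin e ⊕ Fin k) K →ₐ[K]
          MvPolynomial (Fin k) (FractionRing (MvPolynomial (Fin e) K))) (D j))
  haveI : I.IsMaximal := hmax
  letI : Field (MvPolynomial (Fin k) (FractionRing (MvPolynomial (Fin e) K)) ⧸ I) := Ideal.Quotient.field I
  haveI : CharZero (MvPolynomial (Fin k) (FractionRing (MvPolynomial (Fin e) K)) ⧸ I) :=
    charZero_of_injective_algebraMap (R := K) (algebraMap K (MvPolynomial (Fin k) (FractionRing (MvPolynomial (Fin e) K)) ⧸ I)).injective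
  -- vanishing of the reduction gives membership of the coefficients
  have hmem : ∀ S : Polynomial (MvPolynomial (Fin k) (FractionRing (MvPolynomial (Fin e) K))),
      S.map (Ideal.Quotient.mk I) = 0 → ∀ i, S.coeff i ∈ I := by
    intro S hS i
    have := congrArg (fun q => q.coeff i) hS
    simp only [Polynomial.coeff_map, Polynomial.coeff_zero] at this
    exact Ideal.Quotient.eq_zero_iff_mem.1 this
  -- `K[u] → T` is injective
  have hinj : Function.Injective (((Ideal.Quotient.mk I).comp (MvPolynomial.aeval (Sum.elim
      (fun i => MvPolynomial.C (algebraMap (MvPolynomial (Fin e) K)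
        (FractionRing (MvPolynomial (Fin e) K)) (MvPolynomial.X i)))
      (fun j => MvPolynomial.X j)) :
        MvPolynomial (Fin e ⊕ Fin k) K →ₐ[K]
          MvPolynomial (Fin k) (FractionRing (MvPolynomial (Fin e) K))).toRingHom).comp
      (MvPolynomial.rename (Sum.inl : Fin e → Fin e ⊕ Fin k)).toRingHom) := by
    have hfac : ((Ideal.Quotient.mk I).comp (MvPolynomial.aeval (Sum.elim
      (fun i => MvPolynomial.C (algebraMap (MvPolynomial (Fin e) K)
        (FractionRing (MvPolynomial (Fin e) K)) (MvPolynomial.X i)))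
      (fun j => MvPolynomial.X j)) :
        MvPolynomial (Fin e ⊕ Fin k) K →ₐ[K]
          MvPolynomial (Fin k) (FractionRing (MvPolynomial (Fin e) K))).toRingHom).comp
        (MvPolynomial.rename (Sum.inl : Fin e → Fin e ⊕ Fin k)).toRingHom =
        (algebraMap (FractionRing (MvPolynomial (Fin e) K)) (MvPolynomial (Fin k) (FractionRing (MvPolynomial (Fin e) K)) ⧸ I)).comp
          (algebraMap (MvPolynomial (Fin e) K) (FractionRing (MvPolynomial (Fin e) K))) := by
      refine RingHom.ext fun b => ?_
      simp only [RingHom.coe_comp, Function.comp_apply, AlgHom.toRingHom_eq_coe, RingHom.coe_coe]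
      rw [aeval_sumElim_rename_inl]
      rfl
    rw [hfac]
    exact (algebraMap (FractionRing (MvPolynomial (Fin e) K)) (MvPolynomial (Fin k) (FractionRing (MvPolynomial (Fin e) K)) ⧸ I)).injective.comp
      (IsFractionRing.injective (MvPolynomial (Fin e) K) (FractionRing (MvPolynomial (Fin e) K)))
  -- the reduction `p` of `P`, non-zero
  have hp0 : (P.map (MvPolynomial.rename (Sum.inl : Fin e → Fin e ⊕ Fin k)).toRingHom).map
      ((Ideal.Quotient.mk I).comp (MvPolynomial.aeval (Sum.elim
      (fun i => MvPolynomial.C (algebraMap (MvPolynomial (Fin e) K)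
        (FractionRing (MvPolynomial (Fin e) K)) (MvPolynomial.X i)))
      (fun j => MvPolynomial.X j)) :
        MvPolynomial (Fin e ⊕ Fin k) K →ₐ[K]
          MvPolynomial (Fin k) (FractionRing (MvPolynomial (Fin e) K))).toRingHom) ≠ 0 := by
    rw [Polynomial.map_map]
    intro h0
    exact hP ((Polynomial.map_injective _ hinj) (by rw [h0, Polynomial.map_zero]))
  obtain ⟨s, qv, m, u₀, v₀, av, av', hq_irr, hpfac, hv₀, hav⟩ := exists_factor_data hp0
  -- lifts to `F[w][t]`
  have hsurj : Function.Surjective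
      (Polynomial.map (Ideal.Quotient.mk I) : Polynomial (MvPolynomial (Fin k) (FractionRing (MvPolynomial (Fin e) K))) → _) :=
    Polynomial.map_surjective _ Ideal.Quotient.mk_surjective
  choose ql hql using fun i => hsurj (qv i)
  choose al hal using fun i => hsurj (av i)
  choose al' hal' using fun i => hsurj (av' i)
  obtain ⟨ul, hul⟩ := Ideal.Quotient.mk_surjective u₀
  obtain ⟨vl, hvl⟩ := Ideal.Quotient.mk_surjective v₀
  -- one common denominator for everything
  obtain ⟨b, hb0, hbP⟩ := stub_clearDenominators (K := K) (e := e) (k := k)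
    (ι := (Fin s × Fin 3) ⊕ Bool)
    (Sum.elim (fun ij => ![ql ij.1, al ij.1, al' ij.1] ij.2)
      (fun c => bif c then Polynomial.C vl else Polynomial.C ul))
  have hbq : ∀ i, ∃ P₀ : Polynomial (MvPolynomial (Fin e ⊕ Fin k) K), P₀.map (MvPolynomial.aeval (Sum.elim
      (fun i => MvPolynomial.C (algebraMap (MvPolynomial (Fin e) K)
        (FractionRing (MvPolynomial (Fin e) K)) (MvPolynomial.X i)))
      (fun j => MvPolynomial.X j)) :
        MvPolynomial (Fin e ⊕ Fin k) K →ₐ[K]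
          MvPolynomial (Fin k) (FractionRing (MvPolynomial (Fin e) K))).toRingHom =
      Polynomial.C (MvPolynomial.C (algebraMap (MvPolynomial (Fin e) K) (FractionRing (MvPolynomial (Fin e) K)) b)) * ql i :=
    fun i => hbP (Sum.inl (i, 0))
  have hba : ∀ i, ∃ P₀ : Polynomial (MvPolynomial (Fin e ⊕ Fin k) K), P₀.map (MvPolynomial.aeval (Sum.elim
      (fun i => MvPolynomial.C (algebraMap (MvPolynomial (Fin e) K)
        (FractionRing (MvPolynomial (Fin e) K)) (MvPolynomial.X i)))
      (fun j => MvPolynomial.X j)) :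
        MvPolynomial (Fin e ⊕ Fin k) K →ₐ[K]
          MvPolynomial (Fin k) (FractionRing (MvPolynomial (Fin e) K))).toRingHom =
      Polynomial.C (MvPolynomial.C (algebraMap (MvPolynomial (Fin e) K) (FractionRing (MvPolynomial (Fin e) K)) b)) * al i :=
    fun i => hbP (Sum.inl (i, 1))
  have hba' : ∀ i, ∃ P₀ : Polynomial (MvPolynomial (Fin e ⊕ Fin k) K), P₀.map (MvPolynomial.aeval (Sum.elim
      (fun i => MvPolynomial.C (algebraMap (MvPolynomial (Fin e) K)
        (FractionRing (MvPolynomial (Fin e) K)) (MvPolynomial.X i)))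
      (fun j => MvPolynomial.X j)) :
        MvPolynomial (Fin e ⊕ Fin k) K →ₐ[K]
          MvPolynomial (Fin k) (FractionRing (MvPolynomial (Fin e) K))).toRingHom =
      Polynomial.C (MvPolynomial.C (algebraMap (MvPolynomial (Fin e) K) (FractionRing (MvPolynomial (Fin e) K)) b)) * al' i :=
    fun i => hbP (Sum.inl (i, 2))
  choose Q₀ hQ₀ using hbq
  choose A₀ hA₀ using hba
  choose A₀' hA₀' using hba'
  obtain ⟨U₀, hU₀⟩ : ∃ P₀ : Polynomial (MvPolynomial (Fin e ⊕ Fin k) K), P₀.map (MvPolynomial.aeval (Sum.elim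
      (fun i => MvPolynomial.C (algebraMap (MvPolynomial (Fin e) K)
        (FractionRing (MvPolynomial (Fin e) K)) (MvPolynomial.X i)))
      (fun j => MvPolynomial.X j)) :
        MvPolynomial (Fin e ⊕ Fin k) K →ₐ[K]
          MvPolynomial (Fin k) (FractionRing (MvPolynomial (Fin e) K))).toRingHom =
      Polynomial.C (MvPolynomial.C (algebraMap (MvPolynomial (Fin e) K) (FractionRing (MvPolynomial (Fin e) K)) b)) * Polynomial.C ul :=
    hbP (Sum.inr false)
  obtain ⟨V₀, hV₀⟩ : ∃ P₀ : Polynomial (MvPolynomial (Fin e ⊕ Fin k) K), P₀.map (MvPolynomial.aeval (Sum.elim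
      (fun i => MvPolynomial.C (algebraMap (MvPolynomial (Fin e) K)
        (FractionRing (MvPolynomial (Fin e) K)) (MvPolynomial.X i)))
      (fun j => MvPolynomial.X j)) :
        MvPolynomial (Fin e ⊕ Fin k) K →ₐ[K]
          MvPolynomial (Fin k) (FractionRing (MvPolynomial (Fin e) K))).toRingHom =
      Polynomial.C (MvPolynomial.C (algebraMap (MvPolynomial (Fin e) K) (FractionRing (MvPolynomial (Fin e) K)) b)) * Polynomial.C vl :=
    hbP (Sum.inr true)
  -- the constant `b` seen in `F[w][t]`
  have hCb' : (Polynomial.C (MvPolynomial.rename (Sum.inl : Fin e → Fin e ⊕ Fin k) b)).map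
      (MvPolynomial.aeval (Sum.elim
      (fun i => MvPolynomial.C (algebraMap (MvPolynomial (Fin e) K)
        (FractionRing (MvPolynomial (Fin e) K)) (MvPolynomial.X i)))
      (fun j => MvPolynomial.X j)) :
        MvPolynomial (Fin e ⊕ Fin k) K →ₐ[K]
          MvPolynomial (Fin k) (FractionRing (MvPolynomial (Fin e) K))).toRingHom =
        Polynomial.C (MvPolynomial.C (algebraMap (MvPolynomial (Fin e) K) (FractionRing (MvPolynomial (Fin e) K)) b)) := by
    rw [Polynomial.map_C]
    exact congrArg Polynomial.C (aeval_sumElim_rename_inl b)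
  refine ⟨b, hb0, s, ∑ i, m i + 1, m, Q₀, A₀, A₀', U₀, V₀, fun i => ?_, ?_, ?_, fun i => ?_⟩
  · -- irreducibility of the reductions
    rw [hQ₀, Polynomial.map_mul, Polynomial.map_C, hql]
    refine (irreducible_isUnit_mul ?_).2 (hq_irr i)
    refine Polynomial.isUnit_C.2 (IsUnit.mk0 _ fun h0 => hb0 (hinj ?_))
    simp only [RingHom.coe_comp, Function.comp_apply, AlgHom.toRingHom_eq_coe, RingHom.coe_coe,
      map_zero]
    rw [aeval_sumElim_rename_inl]
    exact h0
  · -- test 1: `b^N P - U₀ ∏ Q₀^m`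
    apply hmem
    have h1 : (∏ i, Q₀ i ^ m i).map (MvPolynomial.aeval (Sum.elim
      (fun i => MvPolynomial.C (algebraMap (MvPolynomial (Fin e) K)
        (FractionRing (MvPolynomial (Fin e) K)) (MvPolynomial.X i)))
      (fun j => MvPolynomial.X j)) :
        MvPolynomial (Fin e ⊕ Fin k) K →ₐ[K]
          MvPolynomial (Fin k) (FractionRing (MvPolynomial (Fin e) K))).toRingHom =
        Polynomial.C (MvPolynomial.C (algebraMap (MvPolynomial (Fin e) K) (FractionRing (MvPolynomial (Fin e) K)) b)) ^ (∑ i, m i) *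
          ∏ i, ql i ^ m i := by
      rw [Polynomial.map_prod]
      simp only [Polynomial.map_pow, hQ₀, mul_pow, Finset.prod_mul_distrib,
        Finset.prod_pow_eq_pow_sum]
    rw [Polynomial.map_sub, Polynomial.map_mul, Polynomial.map_mul, Polynomial.map_pow, hCb', hU₀,
      h1]
    have h2 : (Polynomial.C (MvPolynomial.C (algebraMap (MvPolynomial (Fin e) K) (FractionRing (MvPolynomial (Fin e) K)) b)) ^ (∑ i, m i + 1) *
        (P.map (MvPolynomial.rename (Sum.inl : Fin e → Fin e ⊕ Fin k)).toRingHom).map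
          (MvPolynomial.aeval (Sum.elim
      (fun i => MvPolynomial.C (algebraMap (MvPolynomial (Fin e) K)
        (FractionRing (MvPolynomial (Fin e) K)) (MvPolynomial.X i)))
      (fun j => MvPolynomial.X j)) :
        MvPolynomial (Fin e ⊕ Fin k) K →ₐ[K]
          MvPolynomial (Fin k) (FractionRing (MvPolynomial (Fin e) K))).toRingHom -
        Polynomial.C (MvPolynomial.C (algebraMap (MvPolynomial (Fin e) K) (FractionRing (MvPolynomial (Fin e) K)) b)) * Polynomial.C ul *
          (Polynomial.C (MvPolynomial.C (algebraMap (MvPolynomial (Fin e) K) (FractionRing (MvPolynomial (Fin e) K)) b)) ^ (∑ i, m i) *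
            ∏ i, ql i ^ m i) : Polynomial (MvPolynomial (Fin k) (FractionRing (MvPolynomial (Fin e) K)))) =
        Polynomial.C (MvPolynomial.C (algebraMap (MvPolynomial (Fin e) K) (FractionRing (MvPolynomial (Fin e) K)) b)) ^ (∑ i, m i + 1) *
          ((P.map (MvPolynomial.rename (Sum.inl : Fin e → Fin e ⊕ Fin k)).toRingHom).map
            (MvPolynomial.aeval (Sum.elim
      (fun i => MvPolynomial.C (algebraMap (MvPolynomial (Fin e) K)
        (FractionRing (MvPolynomial (Fin e) K)) (MvPolynomial.X i)))
      (fun j => MvPolynomial.X j)) :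
        MvPolynomial (Fin e ⊕ Fin k) K →ₐ[K]
          MvPolynomial (Fin k) (FractionRing (MvPolynomial (Fin e) K))).toRingHom - Polynomial.C ul * ∏ i, ql i ^ m i) := by ring
    rw [h2, Polynomial.map_mul, Polynomial.map_sub, Polynomial.map_mul, Polynomial.map_prod,
      Polynomial.map_map]
    simp only [Polynomial.map_pow, hql, Polynomial.map_C, hul]
    rw [← hpfac, sub_self, mul_zero]
  · -- test 2: `U₀ V₀ - b²`
    apply hmem
    rw [Polynomial.map_sub, Polynomial.map_mul, Polynomial.map_pow, hCb', hU₀, hV₀]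
    have : (Polynomial.C (MvPolynomial.C (algebraMap (MvPolynomial (Fin e) K) (FractionRing (MvPolynomial (Fin e) K)) b)) * Polynomial.C ul *
        (Polynomial.C (MvPolynomial.C (algebraMap (MvPolynomial (Fin e) K) (FractionRing (MvPolynomial (Fin e) K)) b)) * Polynomial.C vl) -
        Polynomial.C (MvPolynomial.C (algebraMap (MvPolynomial (Fin e) K) (FractionRing (MvPolynomial (Fin e) K)) b)) ^ 2 :
          Polynomial (MvPolynomial (Fin k) (FractionRing (MvPolynomial (Fin e) K)))) =
        Polynomial.C (MvPolynomial.C (algebraMap (MvPolynomial (Fin e) K) (FractionRing (MvPolynomial (Fin e) K)) b)) ^ 2 *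
          (Polynomial.C (ul * vl) - 1) := by rw [Polynomial.C_mul]; ring
    rw [this, Polynomial.map_mul, Polynomial.map_sub, Polynomial.map_C, map_mul, hul, hvl, hv₀,
      Polynomial.map_one, Polynomial.C_1, sub_self, mul_zero]
  · -- test 3: Bézout
    apply hmem
    rw [Polynomial.map_sub, Polynomial.map_add, Polynomial.map_mul, Polynomial.map_mul,
      Polynomial.map_pow, ← Polynomial.derivative_map, hCb', hQ₀, hA₀, hA₀',
      Polynomial.derivative_C_mul]
    have : (Polynomial.C (MvPolynomial.C (algebraMap (MvPolynomial (Fin e) K) (FractionRing (MvPolynomial (Fin e) K)) b)) * al i *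
        (Polynomial.C (MvPolynomial.C (algebraMap (MvPolynomial (Fin e) K) (FractionRing (MvPolynomial (Fin e) K)) b)) * ql i) +
        Polynomial.C (MvPolynomial.C (algebraMap (MvPolynomial (Fin e) K) (FractionRing (MvPolynomial (Fin e) K)) b)) * al' i *
          (Polynomial.C (MvPolynomial.C (algebraMap (MvPolynomial (Fin e) K) (FractionRing (MvPolynomial (Fin e) K)) b)) *
            derivative (ql i)) -
        Polynomial.C (MvPolynomial.C (algebraMap (MvPolynomial (Fin e) K) (FractionRing (MvPolynomial (Fin e) K)) b)) ^ 2 :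
          Polynomial (MvPolynomial (Fin k) (FractionRing (MvPolynomial (Fin e) K)))) =
        Polynomial.C (MvPolynomial.C (algebraMap (MvPolynomial (Fin e) K) (FractionRing (MvPolynomial (Fin e) K)) b)) ^ 2 *
          (al i * ql i + al' i * derivative (ql i) - 1) := by ring
    rw [this, Polynomial.map_mul, Polynomial.map_sub, Polynomial.map_add, Polynomial.map_mul,
      Polynomial.map_mul, ← Polynomial.derivative_map, Polynomial.map_one, hql, hal, hal']
    rw [hav i, sub_self, mul_zero]

/-- **Generic factorisation over a chart.**  `K` of characteristic `0`; chart ideal maximal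
(so `T = F[w]/(D)` is a field).  A NON-ZERO `P ∈ K[u][t]` factors generically along the chart:
there are `ρ ∈ K[u] ∖ 0` and finitely many `Q_i ∈ K[u,w][t]`, each reducing to an IRREDUCIBLE
polynomial over `T`, such that at every `K`-point `x` of the chart with `ρ(x) ≠ 0`, every root
of `P(u(x); ·)` in `K` is a root of some `Q_i(x; ·)`, and all roots of each `Q_i(x; ·)` are
simple (the `Q_i` are cleared lifts of the irreducible factors of the image of `P` in `T[t]`).
[folklore] -/
theorem relFactor [CharZero K] (D : Fin k → MvPolynomial (Fin e ⊕ Fin k) K)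
    (hmax : (Ideal.span (Set.range fun j => (MvPolynomial.aeval (Sum.elim
      (fun i => MvPolynomial.C (algebraMap (MvPolynomial (Fin e) K)
        (FractionRing (MvPolynomial (Fin e) K)) (MvPolynomial.X i)))
      (fun j => MvPolynomial.X j)) :
        MvPolynomial (Fin e ⊕ Fin k) K →ₐ[K]
          MvPolynomial (Fin k) (FractionRing (MvPolynomial (Fin e) K))) (D j))).IsMaximal)
    (P : Polynomial (MvPolynomial (Fin e) K)) (hP : P ≠ 0) :
    ∃ ρ : MvPolynomial (Fin e) K, ρ ≠ 0 ∧
      ∃ (s : ℕ) (Q : Fin s → Polynomial (MvPolynomial (Fin e ⊕ Fin k) K)),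
        (∀ i, Irreducible (((Q i).map (MvPolynomial.aeval (Sum.elim
      (fun i => MvPolynomial.C (algebraMap (MvPolynomial (Fin e) K)
        (FractionRing (MvPolynomial (Fin e) K)) (MvPolynomial.X i)))
      (fun j => MvPolynomial.X j)) :
        MvPolynomial (Fin e ⊕ Fin k) K →ₐ[K]
          MvPolynomial (Fin k) (FractionRing (MvPolynomial (Fin e) K))).toRingHom).map
          (Ideal.Quotient.mk (Ideal.span (Set.range fun j => (MvPolynomial.aeval (Sum.elim
      (fun i => MvPolynomial.C (algebraMap (MvPolynomial (Fin e) K)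
        (FractionRing (MvPolynomial (Fin e) K)) (MvPolynomial.X i)))
      (fun j => MvPolynomial.X j)) :
        MvPolynomial (Fin e ⊕ Fin k) K →ₐ[K]
          MvPolynomial (Fin k) (FractionRing (MvPolynomial (Fin e) K))) (D j)))))) ∧
        ∀ x : Fin e ⊕ Fin k → K, (∀ j, MvPolynomial.eval x (D j) = 0) →
          MvPolynomial.eval (x ∘ Sum.inl) ρ ≠ 0 →
            (∀ t, (P.map (MvPolynomial.eval (x ∘ Sum.inl))).eval t = 0 →
              ∃ i, ((Q i).map (MvPolynomial.eval x)).eval t = 0) ∧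
            (∀ i t, ((Q i).map (MvPolynomial.eval x)).eval t = 0 →
              (derivative ((Q i).map (MvPolynomial.eval x))).eval t ≠ 0) := by
  classical
  obtain ⟨b, hb0, s, N, m, Q₀, A₀, A₀', U₀, V₀, hirr, hZ₁mem, hZ₂mem, hZ₃mem⟩ :=
    relFactor_core D hmax P hP
  obtain ⟨b₁, hb₁0, hb₁⟩ := stub_eval_eq_zero_of_mem_span D _ hZ₁mem
  obtain ⟨b₂, hb₂0, hb₂⟩ := stub_eval_eq_zero_of_mem_span D _ hZ₂mem
  choose b₃ hb₃0 hb₃ using fun i => stub_eval_eq_zero_of_mem_span D _ (hZ₃mem i)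
  refine ⟨b * b₁ * b₂ * ∏ i, b₃ i, mul_ne_zero (mul_ne_zero (mul_ne_zero hb0 hb₁0) hb₂0)
    (Finset.prod_ne_zero_iff.2 fun i _ => hb₃0 i), s, Q₀, hirr, fun x hx hρ => ?_⟩
  simp only [map_mul, map_prod, mul_ne_zero_iff, Finset.prod_ne_zero_iff] at hρ
  obtain ⟨⟨⟨hbx, hb₁x⟩, hb₂x⟩, hb₃x⟩ := hρ
  have hb'x : (Polynomial.C (MvPolynomial.rename (Sum.inl : Fin e → Fin e ⊕ Fin k) b)).map
      (MvPolynomial.eval x) = Polynomial.C (MvPolynomial.eval (x ∘ Sum.inl) b) := by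
    rw [Polynomial.map_C, MvPolynomial.eval_rename]
  have hPax : (P.map (MvPolynomial.rename (Sum.inl : Fin e → Fin e ⊕ Fin k)).toRingHom).map
      (MvPolynomial.eval x) = P.map (MvPolynomial.eval (x ∘ Sum.inl)) := by
    rw [Polynomial.map_map]
    congr 1
    refine RingHom.ext fun q => ?_
    simp [MvPolynomial.eval_rename]
  -- evaluated identities
  have e₁ : Polynomial.C (MvPolynomial.eval (x ∘ Sum.inl) b) ^ N *
      P.map (MvPolynomial.eval (x ∘ Sum.inl)) =
        U₀.map (MvPolynomial.eval x) * ∏ i, (Q₀ i).map (MvPolynomial.eval x) ^ m i := by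
    have h0 := hb₁ x hx hb₁x
    rw [Polynomial.map_sub, sub_eq_zero, Polynomial.map_mul, Polynomial.map_mul,
      Polynomial.map_pow, Polynomial.map_prod, hb'x, hPax] at h0
    simpa only [Polynomial.map_pow] using h0
  have e₂ : U₀.map (MvPolynomial.eval x) * V₀.map (MvPolynomial.eval x) =
      Polynomial.C (MvPolynomial.eval (x ∘ Sum.inl) b) ^ 2 := by
    have h0 := hb₂ x hx hb₂x
    rw [Polynomial.map_sub, sub_eq_zero, Polynomial.map_mul, Polynomial.map_pow, hb'x] at h0
    exact h0
  have e₃ : ∀ i, (A₀ i).map (MvPolynomial.eval x) * (Q₀ i).map (MvPolynomial.eval x) +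
      (A₀' i).map (MvPolynomial.eval x) * derivative ((Q₀ i).map (MvPolynomial.eval x)) =
        Polynomial.C (MvPolynomial.eval (x ∘ Sum.inl) b) ^ 2 := by
    intro i
    have h0 := hb₃ i x hx (hb₃x i (Finset.mem_univ i))
    rw [Polynomial.map_sub, sub_eq_zero, Polynomial.map_add, Polynomial.map_mul,
      Polynomial.map_mul, Polynomial.map_pow, ← Polynomial.derivative_map, hb'x] at h0
    exact h0
  exact roots_of_evaluated_identities hbx N m _ _ _ _ _ _ e₁ e₂ e₃

end RelFactor

end Summit.MatrixMultiplication.MatrixMultiplication.Theorems.PairwiseCurvedTilingsLC.Negative
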